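import Literature.Analysis.FluidPDE.BarkerPrange2020VorticityAlignmentTypeIHolds
import HarnessLib

/-!
# Barker–Prange 2020, Theorem 3 (whole space) WITHOUT the compact-support binder on the datum

Analysis/FluidPDE proof file (theorems only: no definition, no named fact, no `sorry`). The tree's discharge
`barkerPrange2020_alignment_concentrating_typeI_holds` (`BarkerPrange2020VorticityAlignmentTypeIHolds.lean`) proves
the named fact `barkerPrange2020_alignment_concentrating_typeI`, whose statement carries the printed hypothesis
`u₀ ∈ C₀^∞` as `HasCompactSupport (u 0)`; the proof never uses it (the binder is discarded: `intro … _ hI`). This file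
records the SAME theorem with the SAME proof for classical Leray–Hopf solutions with the global Type-I bound and NO
support hypothesis on the datum — the form needed to read Theorem 3 on restarted solutions (whose data are slices,
never compactly supported), e.g. by the fluid-computer level dictionary
(`Summits/NavierStokesRegularity/FluidComputer/`). Statement, transcription and proof: see the two sibling files;
the text below is their proof verbatim with the unused binder removed (and the private pull-back lemma repeated).

* `barkerPrange2020_alignment_concentrating_typeI_general` — Barker–Prange 2020, Thm. 3 ((5.3)–(5.4)) for classical
  Leray–Hopf solutions on `ℝ³ × [0, T)` with `|u| ≤ M/√(T − t)`, no compact-support hypothesis: there is `δ > 0`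
  (witnessed by `δ = 1`) such that for every centre `x₀` and every sequence `t⁽ⁿ⁾ ↑ T` in `(0, T)`, bounded vorticity on
  the concentrating balls `B(x₀, δ√(ν(T − t⁽ⁿ⁾)))`, or a uniform modulus of continuity of the vorticity direction on
  them over `{|ω| > d}`, forces `(T, x₀)` to be a regular point.

## References

* T. Barker, C. Prange, *Scale-invariant estimates and vorticity alignment for Navier–Stokes in the half-space with
  no-slip boundary conditions*, Arch. Ration. Mech. Anal. 235 (2020) 881–926 = arXiv:1906.08225, §5.2 Thm. 3
  ((5.3)–(5.4)), Remark 15; §4 (proof of Thm. 1), Prop. 4, Remark 5. [BarkerPrange2020Alignment]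
-/

noncomputable section

open MeasureTheory Set Function Filter Topology TopologicalSpace Metric
open scoped NNReal ENNReal RealInnerProductSpace
open Literature.Analysis Literature.Analysis.FluidPDE Literature.Analysis.FluidPDE.LocalTypeIBlowup

namespace Literature.Analysis.FluidPDE

namespace BarkerPrange2020NoSupport

/-- **`L^∞` norms under an amplitude-`a` space–time affine pull-back** (`β, γ > 0`, any centre):
`‖a · u ∘ Φ‖_{L^∞(Φ⁻¹ S)} = a ‖u‖_{L^∞(S)}` (the tree's `eLpNorm_top_nsZoom` is the parabolic case
`β = c²`, `γ = c`, `a = c`; same proof). [folklore] -/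
private theorem eLpNorm_top_smul_stPull_preimage {a β γ : ℝ} (ha : 0 ≤ a) (hβ : 0 < β)
    (hγ : 0 < γ) (t₀ : ℝ) (x₀ : EuclideanSpace ℝ (Fin 3)) (S : Set (ℝ × (EuclideanSpace ℝ (Fin 3))))
    (u : ℝ → (EuclideanSpace ℝ (Fin 3)) → (EuclideanSpace ℝ (Fin 3))) :
    eLpNorm (uncurry (a • stPull β γ t₀ x₀ u)) ∞
        (volume.restrict (stAffine β γ t₀ x₀ ⁻¹' S)) =
      ENNReal.ofReal a * eLpNorm (uncurry u) ∞ (volume.restrict S) := by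
  have hme := measurableEmbedding_stAffine (E := EuclideanSpace ℝ (Fin 3)) hβ.ne' hγ.ne' t₀ x₀
  rw [eLpNorm_exponent_top, eLpNorm_exponent_top, eLpNormEssSup_eq_essSup_enorm,
    eLpNormEssSup_eq_essSup_enorm]
  have hF : (fun w : ℝ × (EuclideanSpace ℝ (Fin 3)) => ‖uncurry (a • stPull β γ t₀ x₀ u) w‖ₑ) =
      fun w => ENNReal.ofReal a *
        ((fun w' : ℝ × (EuclideanSpace ℝ (Fin 3)) => ‖uncurry u w'‖ₑ) ∘ stAffine β γ t₀ x₀) w := by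
    funext w
    rcases w with ⟨s, y⟩
    simp only [uncurry_apply_pair, Pi.smul_apply, stPull_apply, enorm_smul, Real.enorm_eq_ofReal ha,
      Function.comp_apply, stAffine_apply]
  rw [hF, ENNReal.essSup_const_mul]
  congr 1
  have h2 := hme.essSup_map_measure (μ := volume.restrict (stAffine β γ t₀ x₀ ⁻¹' S))
    (g := fun w' : ℝ × (EuclideanSpace ℝ (Fin 3)) => ‖uncurry u w'‖ₑ)
  rw [map_stAffine_volume_restrict_preimage hβ hγ, finrank_euclideanSpace_fin,
    essSup_ennreal_smul_measure (by simp; positivity)] at h2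
  exact h2.symm

end BarkerPrange2020NoSupport

open BarkerPrange2020NoSupport in
/-- **Barker–Prange 2020, Theorem 3, without the compact-support binder** (whole space; arXiv:1906.08225 §5 p. 18,
(5.3) and (5.4)): for `ν > 0`, `T > 0`, `M`, and a classical unforced Navier–Stokes solution `(u, p)` on `ℝ³ × [0, T)`,
Leray–Hopf from `u 0`, with the global Type-I bound `‖u(t, x)‖ ≤ M/√(T − t)` on `(0, T)`, there is `δ > 0` such that for
every centre `x₀` and every strictly increasing sequence `t⁽ⁿ⁾ → T` in `(0, T)`: (5.3) if the vorticity is bounded on the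
concentrating balls `B(x₀, δ√(ν(T − t⁽ⁿ⁾)))` then `(T, x₀)` is not a backward singular point; (5.4) if for some `d > 0` and
some modulus `η` the vorticity direction is `η`-continuous on those balls over `{|ω| > d}` (`SliceAligned`) then `(T, x₀)`
is not a backward singular point. Same proof as `barkerPrange2020_alignment_concentrating_typeI_holds` (ν-normalisation;
Steps 1–3 `exists_zoomLimit_at_singular_along`; Step 4 `dir_eq_of_sliceAligned_along` / vanishing rescaled vorticity;
globalisation by analyticity; Step 5 Prop. 4 via the KNSS Liouville theorem); the printed `u₀ ∈ C₀^∞` is not used.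
[cite: BarkerPrange2020Alignment, Thm. 3 ((5.3)–(5.4), arXiv:1906.08225 §5.2 p. 18) with §4 (proof of Thm. 1), Prop. 4 and Remark 5 (p. 5)] -/
theorem barkerPrange2020_alignment_concentrating_typeI_general :
  ∀ (ν T M : ℝ), 0 < ν → 0 < T →
    ∀ (u : ℝ → EuclideanSpace ℝ (Fin 3) → EuclideanSpace ℝ (Fin 3))
      (p : ℝ → EuclideanSpace ℝ (Fin 3) → ℝ),
      IsClassicalNSSolutionOn (Ico 0 T) ν 0 u p →
      IsLerayHopfOn T ν 0 (u 0) u →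
      (∀ t ∈ Ioo 0 T, ∀ x : EuclideanSpace ℝ (Fin 3), ‖u t x‖ ≤ M / Real.sqrt (T - t)) →
      ∃ δ : ℝ, 0 < δ ∧
        ∀ (x₀ : EuclideanSpace ℝ (Fin 3)) (s : ℕ → ℝ),
          (∀ n, s n ∈ Ioo 0 T) → StrictMono s → Tendsto s atTop (𝓝 T) →
          ((∃ K : ℝ, ∀ n, ∀ x ∈ ball x₀ (δ * Real.sqrt (ν * (T - s n))), ‖curl (u (s n)) x‖ ≤ K) →
              ¬ IsBackwardSingularPoint u (T, x₀)) ∧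
          (∀ (d : ℝ) (η : ℝ → ℝ), 0 < d → Continuous η → η 0 = 0 →
            (∀ n, BarkerPrange2020.SliceAligned ν T u x₀ δ d η (s n)) →
              ¬ IsBackwardSingularPoint u (T, x₀)) := by
  intro ν T M hν hT u p hcl hLH hI
  refine ⟨1, one_pos, fun x₀ s hs _ hsT => ?_⟩
  -- ## ν-normalisation: `v(τ, x) = ν⁻¹ u(τ/ν, x)` on `[0, νT)` has unit viscosity
  set v : ℝ → (EuclideanSpace ℝ (Fin 3)) → (EuclideanSpace ℝ (Fin 3)) := timeRescale ν⁻¹ ν⁻¹ u with hvdef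
  set q : ℝ → (EuclideanSpace ℝ (Fin 3)) → ℝ := timeRescale ν⁻¹ (ν⁻¹ ^ 2) p with hqdef
  have hνT : 0 < ν * T := mul_pos hν hT
  have hvst : v = ν⁻¹ • stPull ν⁻¹ 1 0 0 u := by
    funext τ x
    simp only [hvdef, timeRescale_apply, smul_stPull_apply, zero_add, one_smul]
  have hv_apply : ∀ τ x, v τ x = ν⁻¹ • u (ν⁻¹ * τ) x := fun τ x => rfl
  have hcl' : IsClassicalNSSolutionOn (Ico 0 (ν * T)) 1 0 v q := by
    have hmaps : MapsTo (fun τ => ν⁻¹ * τ) (Ico 0 (ν * T)) (Ico 0 T) := by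
      intro τ hτ
      refine ⟨by have := hτ.1; positivity, ?_⟩
      rw [inv_mul_lt_iff₀ hν]
      exact hτ.2
    have h := hcl.viscosityRescale_set hν.ne' hmaps (uniqueDiffOn_Ico 0 (ν * T))
    rwa [timeRescale_zero_force] at h
  have hLH' : IsLerayHopfOn (ν * T) 1 0 (v 0) v := by
    have h := hLH.viscosityRescale (c := ν⁻¹) (inv_pos.2 hν)
    have e1 : T / ν⁻¹ = ν * T := by rw [div_inv_eq_mul, mul_comm]
    have e2 : ν⁻¹ * ν = 1 := inv_mul_cancel₀ hν.ne'
    have e3 : timeRescale ν⁻¹ (ν⁻¹ ^ 2) (0 : ℝ → (EuclideanSpace ℝ (Fin 3)) → (EuclideanSpace ℝ (Fin 3))) = 0 :=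
      timeRescale_zero_force _ _
    have e4 : ν⁻¹ • u 0 = v 0 := by
      funext x
      rw [hv_apply, mul_zero, Pi.smul_apply]
    rw [e1, e2, e3, e4] at h
    exact h
  have hI' : ∀ τ ∈ Ioo 0 (ν * T), ∀ x : EuclideanSpace ℝ (Fin 3),
      ‖v τ x‖ ≤ (M / Real.sqrt ν) / Real.sqrt (ν * T - τ) := by
    intro τ hτ x
    have hτ' : ν⁻¹ * τ ∈ Ioo 0 T := (inv_mul_mem_Ioo_iff hν).2 hτ
    have h := hI _ hτ' x
    have hsν : 0 < Real.sqrt ν := Real.sqrt_pos.2 hν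
    have hsd : 0 < Real.sqrt (ν * T - τ) := Real.sqrt_pos.2 (by linarith [hτ.2])
    have e : Real.sqrt (T - ν⁻¹ * τ) = Real.sqrt (ν * T - τ) / Real.sqrt ν := by
      rw [show T - ν⁻¹ * τ = (ν * T - τ) / ν by field_simp, Real.sqrt_div' _ hν.le]
    rw [e] at h
    rw [hv_apply, norm_smul, norm_inv, Real.norm_of_nonneg hν.le]
    have hM : 0 ≤ M := by
      have h0 : 0 < Real.sqrt (ν * T - τ) / Real.sqrt ν := div_pos hsd hsν
      by_contra hM
      push Not at hM
      linarith [norm_nonneg (u (ν⁻¹ * τ) x), div_neg_of_neg_of_pos hM h0]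
    have key : ν⁻¹ * (M / (Real.sqrt (ν * T - τ) / Real.sqrt ν)) = M / Real.sqrt ν / Real.sqrt (ν * T - τ) := by
      have hνs : Real.sqrt ν * Real.sqrt ν = ν := Real.mul_self_sqrt hν.le
      field_simp
      nlinarith [hνs]
    calc ν⁻¹ * ‖u (ν⁻¹ * τ) x‖ ≤ ν⁻¹ * (M / (Real.sqrt (ν * T - τ) / Real.sqrt ν)) := by gcongr
      _ = M / Real.sqrt ν / Real.sqrt (ν * T - τ) := key
  -- the singular point moves to `(νT, x₀)`
  have hsingv : IsBackwardSingularPoint u (T, x₀) →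
      IsBackwardSingularPoint v ((ν * T, x₀) : ℝ × (EuclideanSpace ℝ (Fin 3))) := by
    intro hsg r hr
    have hpre : stAffine ν⁻¹ 1 0 (0 : EuclideanSpace ℝ (Fin 3)) ⁻¹' (Ioo (T - r ^ 2 / ν) T ×ˢ ball x₀ r) =
        parabolicCylinder r ((ν * T, x₀) : ℝ × (EuclideanSpace ℝ (Fin 3))) := by
      rw [stAffine_preimage_cylinder (inv_pos.2 hν) one_pos, parabolicCylinder]
      have e1 : (T - r ^ 2 / ν - 0) / ν⁻¹ = ν * T - r ^ 2 := by
        field_simp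
        ring
      have e2 : (T - 0) / ν⁻¹ = ν * T := by rw [sub_zero, div_inv_eq_mul, mul_comm]
      rw [e1, e2, inv_one, sub_zero, one_smul, div_one]
    rw [hvst, ← hpre, eLpNorm_top_smul_stPull_preimage (inv_pos.2 hν).le (inv_pos.2 hν) one_pos]
    -- the set `(T - r²/ν, T) × B(x₀, r)` contains a backward ball at `(T, x₀)`
    set r₁ : ℝ := min r (r / Real.sqrt ν) with hr₁
    have hr₁ : 0 < r₁ := lt_min hr (div_pos hr (Real.sqrt_pos.2 hν))
    have hsub : parabolicCylinder r₁ ((T, x₀) : ℝ × (EuclideanSpace ℝ (Fin 3))) ⊆ Ioo (T - r ^ 2 / ν) T ×ˢ ball x₀ r := by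
      rintro ⟨t, x⟩ htx
      rw [mem_parabolicCylinder] at htx
      obtain ⟨⟨ht1, ht2⟩, hx⟩ := htx
      have h1 : r₁ ≤ r := min_le_left _ _
      have h2 : r₁ ^ 2 ≤ r ^ 2 / ν := by
        have h3 : r₁ ≤ r / Real.sqrt ν := min_le_right _ _
        have h4 : (r / Real.sqrt ν) ^ 2 = r ^ 2 / ν := by rw [div_pow, Real.sq_sqrt hν.le]
        rw [← h4]
        exact pow_le_pow_left₀ hr₁.le h3 2
      refine ⟨⟨by simp only at ht1; linarith, ht2⟩, ?_⟩
      rw [mem_ball]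
      exact lt_of_lt_of_le hx h1
    have htop : eLpNorm (uncurry u) ⊤ (volume.restrict (Ioo (T - r ^ 2 / ν) T ×ˢ ball x₀ r)) = ⊤ :=
      top_le_iff.1 ((hsg r₁ hr₁).symm.le.trans (eLpNorm_mono_measure _ (Measure.restrict_mono hsub le_rfl)))
    rw [htop, ENNReal.mul_top]
    simpa using hν
  -- vorticity of `v`: `curl v(τ) = ν⁻¹ curl u(τ/ν)`
  have hcurlv : ∀ τ x, curl (v τ) x = ν⁻¹ • curl (u (ν⁻¹ * τ)) x := by
    intro τ x
    rw [hvst, curl_smul_stPull, mul_one, zero_add, zero_add, one_smul]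
  -- the times `ν s n`
  set s' : ℕ → ℝ := fun n => ν * s n with hs'
  have hs'mem : ∀ n, s' n ∈ Ioo 0 (ν * T) := fun n =>
    ⟨mul_pos hν (hs n).1, mul_lt_mul_of_pos_left (hs n).2 hν⟩
  have hs'T : Tendsto s' atTop (𝓝 (ν * T)) := hsT.const_mul ν
  -- ## the common core: zoom limit at the singular vertex, and the two endings
  have core : IsBackwardSingularPoint u (T, x₀) →
      ∃ (M' : ℝ) (U : ℝ → (EuclideanSpace ℝ (Fin 3)) → (EuclideanSpace ℝ (Fin 3)))
        (P : ℝ → (EuclideanSpace ℝ (Fin 3)) → ℝ)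
        (H : ℝ → (EuclideanSpace ℝ (Fin 3)) → (EuclideanSpace ℝ (Fin 3)) →L[ℝ] (EuclideanSpace ℝ (Fin 3)))
        (φ : ℕ → ℕ), StrictMono φ ∧
        IsTypeIAncientMild M' U ∧
        IsSuitableWeakSolutionOn (slab (EuclideanSpace ℝ (Fin 3)) (Iio 0) isOpen_Iio) 1 0 U P ∧
        HasWeakSpatialGradientOn (slab (EuclideanSpace ℝ (Fin 3)) (Iio 0) isOpen_Iio) U H ∧
        typeIBound (Iio (0 : ℝ) ×ˢ univ) U P H < ⊤ ∧
        IsBackwardSingularPoint U 0 ∧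
        ∀ y : EuclideanSpace ℝ (Fin 3),
          Tendsto (fun j => ((T - s (φ j)) / 4) • curl (u (s (φ j)))
            (x₀ + (Real.sqrt (ν * (T - s (φ j))) / 2) • y)) atTop (𝓝 (curl (U (-4)) y)) := by
    intro hsg
    obtain ⟨φ, hφ, U, P, H, hU, hswU, hwgU, hIU, hsingU, hconv⟩ :=
      exists_zoomLimit_at_singular_along hνT hcl' hLH' hI' (hsingv hsg) hs'mem hs'T
    refine ⟨_, U, P, H, φ, hφ, hU, hswU, hwgU, hIU, hsingU, fun y => ?_⟩
    refine (hconv y).congr fun j => ?_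
    simp only [hs']
    rw [hcurlv, smul_smul, show ν⁻¹ * (ν * s (φ j)) = s (φ j) by field_simp,
      show ν * T - ν * s (φ j) = ν * (T - s (φ j)) by ring,
      show (ν * (T - s (φ j))) / 4 * ν⁻¹ = (T - s (φ j)) / 4 by field_simp]
  -- the ending shared by both branches: a direction `e ≠ 0` with `curl U(-4) ∥ e` on `B(0, 2)`
  have ending : ∀ {M' : ℝ} {U : ℝ → (EuclideanSpace ℝ (Fin 3)) → (EuclideanSpace ℝ (Fin 3))}
      {P : ℝ → (EuclideanSpace ℝ (Fin 3)) → ℝ}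
      {H : ℝ → (EuclideanSpace ℝ (Fin 3)) → (EuclideanSpace ℝ (Fin 3)) →L[ℝ] (EuclideanSpace ℝ (Fin 3))},
      IsTypeIAncientMild M' U →
      IsSuitableWeakSolutionOn (slab (EuclideanSpace ℝ (Fin 3)) (Iio 0) isOpen_Iio) 1 0 U P →
      HasWeakSpatialGradientOn (slab (EuclideanSpace ℝ (Fin 3)) (Iio 0) isOpen_Iio) U H →
      typeIBound (Iio (0 : ℝ) ×ˢ univ) U P H < ⊤ →
      IsBackwardSingularPoint U 0 →
      ∀ {e : EuclideanSpace ℝ (Fin 3)}, e ≠ 0 →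
      (∀ y ∈ ball (0 : EuclideanSpace ℝ (Fin 3)) 2, ∃ a : ℝ, curl (U (-4)) y = a • e) → False := by
    intro M' U P H hU hswU hwgU hIU hsingU e he hball
    have han : AnalyticOnNhd ℝ (U (-4)) univ := hU.analyticOnNhd_slice_univ (by norm_num)
    have hpar := curl_parallel_of_parallel_on_open han isOpen_ball ⟨0, mem_ball_self (by norm_num)⟩ hball
    exact not_isBackwardSingularPoint_of_typeIAncientMild_of_curl_parallel_slice hU hswU hwgU hIU
      (by norm_num : (-4 : ℝ) < 0) he hpar hsingU
  have he₀ : (EuclideanSpace.single (0 : Fin 3) (1 : ℝ) : EuclideanSpace ℝ (Fin 3)) ≠ 0 := by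
    intro h
    have := congrArg (fun w : EuclideanSpace ℝ (Fin 3) => w 0) h
    simp at this
  -- geometry of the rescaled points: `x₀ + (√(ν(T - s))/2) y` lies in the concentrating ball for `‖y‖ < 2`
  have hLr : ∀ n, Real.sqrt (ν * (T - s n)) / 2 * 2 ≤ 1 * Real.sqrt (ν * (T - s n)) := fun n => by
    rw [div_mul_cancel₀ _ two_ne_zero, one_mul]
  have hLpos : ∀ n, 0 < Real.sqrt (ν * (T - s n)) / 2 := fun n =>
    div_pos (Real.sqrt_pos.2 (mul_pos hν (by linarith [(hs n).2]))) two_pos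
  have hTs : ∀ n, 0 < T - s n := fun n => by linarith [(hs n).2]
  have hL0' : ∀ {φ : ℕ → ℕ}, StrictMono φ →
      Tendsto (fun j => Real.sqrt (ν * (T - s (φ j))) / 2) atTop (𝓝 0) := by
    intro φ hφ
    have h1 : Tendsto (fun j => ν * (T - s (φ j))) atTop (𝓝 0) := by
      have h : Tendsto (fun j => ν * (T - s (φ j))) atTop (𝓝 (ν * (T - T))) :=
        (tendsto_const_nhds.sub (hsT.comp hφ.tendsto_atTop)).const_mul ν
      rwa [sub_self, mul_zero] at h
    have h2 : Tendsto (fun j => Real.sqrt (ν * (T - s (φ j)))) atTop (𝓝 0) := by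
      have h := (Real.continuous_sqrt.tendsto 0).comp h1
      rwa [Function.comp_def, Real.sqrt_zero] at h
    have h3 := h2.div_const 2
    rwa [zero_div] at h3
  have ha0' : ∀ {φ : ℕ → ℕ}, StrictMono φ → Tendsto (fun j => (T - s (φ j)) / 4) atTop (𝓝 0) := by
    intro φ hφ
    have h : Tendsto (fun j => (T - s (φ j)) / 4) atTop (𝓝 ((T - T) / 4)) :=
      (tendsto_const_nhds.sub (hsT.comp hφ.tendsto_atTop)).div_const 4
    rwa [sub_self, zero_div] at h
  refine ⟨fun hK hsg => ?_, fun d η _ hη hη0 hal hsg => ?_⟩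
  · -- ## (5.3): bounded vorticity on the concentrating balls
    obtain ⟨K, hK⟩ := hK
    obtain ⟨M', U, P, H, φ, hφ, hU, hswU, hwgU, hIU, hsingU, hconv⟩ := core hsg
    refine ending hU hswU hwgU hIU hsingU he₀ fun y hy => ⟨0, ?_⟩
    rw [zero_smul]
    -- the rescaled vorticities tend to `0` on `B(0, 2)` (§5.1: `|Ω⁽ⁿ⁾(y, -t₀)| ≤ (R⁽ⁿ⁾)² K → 0`)
    have hpt : ∀ j, x₀ + (Real.sqrt (ν * (T - s (φ j))) / 2) • y ∈
        ball x₀ (1 * Real.sqrt (ν * (T - s (φ j)))) := by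
      intro j
      rw [mem_ball, dist_eq_norm, add_sub_cancel_left, norm_smul, Real.norm_of_nonneg (hLpos (φ j)).le]
      calc Real.sqrt (ν * (T - s (φ j))) / 2 * ‖y‖ < Real.sqrt (ν * (T - s (φ j))) / 2 * 2 :=
            mul_lt_mul_of_pos_left (mem_ball_zero_iff.1 hy) (hLpos (φ j))
        _ ≤ 1 * Real.sqrt (ν * (T - s (φ j))) := hLr (φ j)
    have hzero : Tendsto (fun j => ((T - s (φ j)) / 4) • curl (u (s (φ j)))
        (x₀ + (Real.sqrt (ν * (T - s (φ j))) / 2) • y)) atTop (𝓝 0) := by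
      refine squeeze_zero_norm (a := fun j => (T - s (φ j)) / 4 * K) (fun j => ?_) ?_
      · have hnn : 0 ≤ (T - s (φ j)) / 4 := by have := hTs (φ j); positivity
        rw [norm_smul, Real.norm_of_nonneg hnn]
        exact mul_le_mul_of_nonneg_left (hK (φ j) _ (hpt j)) hnn
      · have h := (ha0' hφ).mul_const K
        rwa [zero_mul] at h
    exact tendsto_nhds_unique (hconv y) hzero
  · -- ## (5.4): slice alignment on the concentrating balls
    obtain ⟨M', U, P, H, φ, hφ, hU, hswU, hwgU, hIU, hsingU, hconv⟩ := core hsg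
    have hdir := dir_eq_of_sliceAligned_along (s := s ∘ φ) hη hη0 (fun j => hal (φ j))
      (a := fun j => (T - s (φ j)) / 4) (L := fun j => Real.sqrt (ν * (T - s (φ j))) / 2) (r := 2)
      (fun j => by have := hTs (φ j); positivity) (ha0' hφ) (fun j => hLpos (φ j)) (hL0' hφ)
      (fun j => hLr (φ j)) hconv
    by_cases hex : ∃ y ∈ ball (0 : EuclideanSpace ℝ (Fin 3)) 2, curl (U (-4)) y ≠ 0
    · obtain ⟨y₁, hy₁, hne⟩ := hex
      refine ending hU hswU hwgU hIU hsingU hne fun y hy => ?_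
      by_cases hzero : curl (U (-4)) y = 0
      · exact ⟨0, by rw [hzero, zero_smul]⟩
      · refine ⟨‖curl (U (-4)) y‖ * ‖curl (U (-4)) y₁‖⁻¹, ?_⟩
        rw [← smul_smul, ← hdir y hy y₁ hy₁ hzero hne, smul_smul,
          mul_inv_cancel₀ (norm_ne_zero_iff.2 hzero), one_smul]
    · push Not at hex
      exact ending hU hswU hwgU hIU hsingU he₀ fun y hy => ⟨0, by rw [hex y hy, zero_smul]⟩

end Literature.Analysis.FluidPDE

end
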